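import Literature.Computability.AlgebraicComplexity.QPBoundedClosure
import Literature.Computability.AlgebraicComplexity.AffineSignDetBounds
import Literature.Computability.AlgebraicComplexity.SharpPBitsPPoly
import Literature.Computability.Complexity.CoinCounting
import Literature.Computability.Complexity.CountingProofs
import HarnessLib

/-!
# Stub `stub_perBitsQP` of crux `TauBurgisserDet`: Bürgisser's Lemma 2.12 at quasi-polynomial
granularity, sign-determinantal form

If `τ(DET_m)` is p-bounded and SignDetQP holds — for all large `n` some `N · per_n^d` (`N ≠ 0`,
`d ≥ 1`) is the determinant of an `m × m` matrix of affine forms with coefficients in `{−1, 0, 1}`,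
`m ≤ 2^((log₂ n + c)^c)` — then `PP ⊆ ⋃_c SIZE(2^((log₂ n + c)^c))` (`stub_perBitsQP`).

The proof is the tree's discharge of Bürgisser's Lemma 2.12 (`SharpPBitsPPoly.lean`,
`cktSize_testBit_countWitnesses`) re-run with "an optimal constant-free circuit for
`(det A(B'))² = N² (2^p f)^{2d}`" in place of "an optimal constant-free circuit for `per B`": for
`L ∈ PP` with witness relation `R ∈ P` and `p(n)` coins, the counting polynomial `f` of a
`B₂`-circuit for `R` on pairs (`exists_countPoly`) has `2^p f = per B'` for a `p × p` matrix `B'`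
with cheap entries (`exists_permanent_boolSum`, `exists_perProjection_matrix`), `p = pd(n) ≥ n₀`
p-bounded; substituting the entries of `B'` into `det A = N · per_p^d` and squaring gives a
constant-free circuit of quasi-polynomial size for `W = N² (2^p f)^{2d}`, whose value
`N² (2^p #{y | ⟨x,y⟩ ∈ R})^{2d}` at `x ∈ {0,1}ⁿ` is recovered exactly by simulation modulo `2^ℓ`
(`cktSize_testBits_aeval_eval`; `ℓ` from the crude bounds `signDetExpr_bounds`) and compared
with the threshold `N² (2^p (2^{p(n)}/2 + 1))^{2d}` (`tbd_cktSize_decide_le`), which is the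
majority vote `2^{p(n)} < 2 #{y | ⟨x,y⟩ ∈ R}` (`half_lt_uniformProb_iff`); the size is
quasi-polynomial in `n` (`IsQPBounded` closure, `QPBoundedClosure.lean`).

References: P. Bürgisser, *On defining integers and proving arithmetic circuit lower bounds*,
Comput. Complexity 18 (2009) 81–103, Lemma 2.12 (= ECCC TR06-113, Lemma 2.12); H. Vollmer,
*Introduction to Circuit Complexity* (1999), §1.1 (comparator).
-/

set_option linter.dupNamespace false

noncomputable section

namespace Summit.ValiantsHypothesis.ValiantsHypothesis.Theorems.IntegralOrbitsTauBurgisserDet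

open MvPolynomial Literature.Computability.AlgebraicComplexity Literature.Computability.Complexity
  Literature.Computability.AlgebraicComplexity.ArithCircuit
  Literature.Computability.AlgebraicComplexity.CircuitArith _root_.Computability

/-! ### A threshold comparator -/

/-- **Comparing an `ℓ`-bit number with a hard-wired threshold** (Vollmer 1999, §1.1): from the
`ℓ` bits of `N(x) < 2^ℓ`, one adder on `ℓ + 1` bits decides `T ≤ N(x)` (bit `ℓ` of
`N(x) + 2^ℓ − T`; a constant if `T > 2^ℓ`). [cite: Vollmer1999, §1.1] -/
theorem tbd_cktSize_decide_le {ι : Type*} {ℓ s : ℕ} {Nv : (ι → Bool) → ℕ} (T : ℕ)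
    (h : CktSize B2 (fun x => testBits ℓ (Nv x)) s) (hN : ∀ x, Nv x < 2 ^ ℓ) :
    CktSize B2 (fun x (_ : Unit) => decide (T ≤ Nv x))
      (s + 1 + (ℓ + 1) * 1 + (ℓ + 1) * ((ℓ + 1) * 1 + (ℓ + 1) * 1)) := by
  rcases le_or_gt T (2 ^ ℓ) with hT | hT
  · have h1 : CktSizeVia (fun x : ι → Bool => x) (fun x => testBits (ℓ + 1) (Nv x)) (s + 1) :=
      (CktSizeVia.of_cktSize_id h).widen hN
    have h2 : CktSizeVia (fun x : ι → Bool => x) (fun _ => testBits (ℓ + 1) (2 ^ ℓ - T))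
        ((ℓ + 1) * 1) := by
      simpa using CktSizeVia.constRow (fun x : ι → Bool => x) (testBits (ℓ + 1) (2 ^ ℓ - T))
    have h3 := (h1.pair h2).trans
      ((cktSizeVia_add (ℓ + 1)).reparam fun x : ι → Bool => (Nv x, 2 ^ ℓ - T))
    refine (h3.outMap fun _ : Unit => Fin.last ℓ).toCktSize.congr fun x _ => ?_
    simp only [testBits_apply, Fin.val_last]
    by_cases hle : T ≤ Nv x
    · rw [decide_eq_true hle, show Nv x + (2 ^ ℓ - T) = 2 ^ ℓ + (Nv x - T) by omega,
        Nat.testBit_two_pow_add_eq, Nat.testBit_lt_two_pow (by have := hN x; omega)]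
      rfl
    · rw [decide_eq_false hle, Nat.testBit_lt_two_pow (by have := hN x; omega)]
  · refine ((cktSize_const ι false).congr fun x _ => ?_).of_le (by omega)
    rw [eq_comm, decide_eq_false_iff_not, not_le]
    exact (hN x).trans hT

/-! ### The size of the construction is quasi-polynomial -/

/-- The gate count `(T + 1) (2 + 65 (ℓ + 2)³) + 1 + (ℓ + 1) + 2 (ℓ + 1)²` of `tbd_cktSize_majority`
(simulation of a `τ`-optimal circuit of cost `≤ T` modulo `2^ℓ`, plus the comparator) is
quasi-polynomially bounded along quasi-polynomially bounded `T`, `ℓ`. [folklore] -/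
theorem tbd_isQPBounded_size {T ℓ : ℕ → ℕ} (hT : IsQPBounded T) (hℓ : IsQPBounded ℓ) :
    IsQPBounded fun n => (T n + 1) * (2 * 1 + 65 * (ℓ n + 2) ^ 3) + 1 + (ℓ n + 1) * 1 +
      (ℓ n + 1) * ((ℓ n + 1) * 1 + (ℓ n + 1) * 1) := by
  have hℓ1 : IsQPBounded fun n => ℓ n + 1 := IsQPBounded.add hℓ (IsQPBounded.const 1)
  exact IsQPBounded.add (IsQPBounded.add (IsQPBounded.add
    (IsQPBounded.mul (IsQPBounded.add hT (IsQPBounded.const 1))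
      (IsQPBounded.add (IsQPBounded.const (2 * 1)) (IsQPBounded.mul (IsQPBounded.const 65)
        (IsQPBounded.pow (IsQPBounded.add hℓ (IsQPBounded.const 2)) 3))))
    (IsQPBounded.const 1))
    (IsQPBounded.mul hℓ1 (IsQPBounded.const 1)))
    (IsQPBounded.mul hℓ1 (IsQPBounded.add (IsQPBounded.mul hℓ1 (IsQPBounded.const 1))
      (IsQPBounded.mul hℓ1 (IsQPBounded.const 1))))

/-! ### The fixed-length core: a majority circuit from a sign-determinantal expression -/

/-- **The majority bit `[2^m < 2 · #{y | ⟨x, y⟩ ∈ R}]` by Boolean circuits, from a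
sign-determinantal expression `det A = N · per_p^d`** (Bürgisser 2009, proof of Lemma 2.12,
re-run): from a `B₂`-program of size `S` for `(x, y) ↦ [⟨x, y⟩ ∈ R]` on `{0,1}ⁿ × {0,1}^m`,
arithmetise the count (`exists_countPoly`), write its Boolean sum `f` as `2^{-p} per B'` for a
`p × p` matrix `B'` with cheap entries, `p ≥ cfBound + 60 S + 3` (`exists_permanent_boolSum`,
`exists_perProjection_matrix`), substitute the entries of `B'` into `det A = N · per_p^d` and
square: `W = (det A(B'))² = N² (2^p f)^{2d}` is constant-free of cost `≤ τ(DET) + …`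
(the bound `T`); simulate an optimal circuit for `W` modulo `2^ℓ` (`cktSize_testBits_aeval_eval`,
`ℓ = 2E(p + m + 1) + 1` from the crude bounds `|N| ≤ 2^E`, `d ≤ E`, `E = X² + 2p²X`) and compare
`W(x)` with the hard-wired threshold `N² (2^p (2^m / 2 + 1))^{2d}`. [cite: Burgisser2009, Lemma 2.12] -/
theorem tbd_cktSize_majority {c₁ : ℕ}
    (hdet : ∀ k, constantFreeComplexity (detPoly (Fin k) ℤ) ≤ k ^ c₁ + c₁)
    (R : Language Bool) (n m S CF pd X : ℕ)
    (hCF : cfBound (60 * S + 1) (3 * S + 2) (m + S) ≤ CF) (hpd : CF + 60 * S + 3 ≤ pd)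
    (hR : CktSize B2 (fun (w : Fin n ⊕ Fin m → Bool) (_ : Unit) =>
      R.boolIndicator (boolPair (List.ofFn fun i => w (.inl i)) (List.ofFn fun j => w (.inr j)))) S)
    {mA d : ℕ} {Nz : ℤ} (A : Matrix (Fin mA) (Fin mA) (MvPolynomial (Fin pd × Fin pd) ℤ))
    (hd : 1 ≤ d) (hmA : mA ≤ X) (hNz : Nz ≠ 0) (hdeg : ∀ i j, (A i j).totalDegree ≤ 1)
    (hco : ∀ i j s, |coeff s (A i j)| ≤ 1) (hA : A.det = C Nz * perPoly (Fin pd) ℤ ^ d)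
    (E ℓ T : ℕ) (hE : E = X * X + 2 * pd * pd * X) (hℓ : ℓ = 2 * E * (pd + m + 1) + 1)
    (hT : T = X ^ c₁ + c₁ + X * X * (2 * (pd * pd) + 1) + pd * pd * (pd + 2) + 1) :
    CktSize B2 (fun (x : Fin n → Bool) (_ : Unit) =>
      decide (2 ^ m < 2 * countWitnesses R m (List.ofFn x)))
      ((T + 1) * (2 * 1 + 65 * (ℓ + 2) ^ 3) + 1 + (ℓ + 1) * 1 + (ℓ + 1) * ((ℓ + 1) * 1 + (ℓ + 1) * 1)) := by
  classical
  -- [1] the circuit for `R` on pairs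
  obtain ⟨Q, hQB, hQs, hQe⟩ := hR.toCircuit
  -- [2] the counting polynomial and its constant-free circuit
  obtain ⟨G, ⟨P, hP2, hPc, hPe, hPs, hPd⟩, hG⟩ := exists_countPoly Q hQB
  -- [3] the permanent form of its Boolean sum, padded to dimension `pd`
  obtain ⟨N, K, B, hNK, hB, hper⟩ := ArithCircuit.exists_permanent_boolSum P hP2 hPc
  have hPg : P.gates.length ≤ 60 * S + 1 := by unfold ArithCircuit.size at hPs; omega
  have hNKle : N + K ≤ CF :=
    hNK.trans ((cfBound_mono hPg (hPd.trans (by omega)) (by omega)).trans hCF)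
  obtain ⟨B', hB', hper'⟩ := ArithCircuit.exists_perProjection_matrix (boolSum P.eval) B hB hper pd
    (by omega) (by omega)
  -- the count
  set cnt : (Fin n → Bool) → ℕ := fun x =>
    (Finset.univ.filter fun y : Fin m → Bool => Q.eval (Sum.elim x y) = true).card with hcnt
  have hcnt_eq : ∀ x, countWitnesses R m (List.ofFn x) = cnt x := fun x =>
    countWitnesses_eq_card_filter R m (List.ofFn x) _ fun y => by
      rw [hQe, ← Set.mem_iff_boolIndicator]
      simp only [Sum.elim_inl, Sum.elim_inr]
      exact Iff.rfl
  have hcnt_le : ∀ x, cnt x ≤ 2 ^ m := fun x =>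
    (Finset.card_filter_le _ _).trans (by simp [Finset.card_univ])
  have hfeval : ∀ x : Fin n → Bool, eval (toK ℤ ∘ x) (boolSum P.eval) = (cnt x : ℤ) := by
    intro x
    have hPe' : P.eval = G := hPe
    rw [hPe', hG x]
  -- [4] substitute the entries of `B'` into `det A = N per^d` and square
  set W : MvPolynomial (Fin n) ℤ :=
    (aeval (fun ij : Fin pd × Fin pd => B' ij.1 ij.2) A.det) ^ 2 with hW
  set Wv : (Fin n → Bool) → ℕ := fun x => Nz.natAbs ^ 2 * (2 ^ pd * cnt x) ^ (2 * d) with hWv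
  have hWeq : W = (C Nz * (C ((2 : ℤ) ^ pd) * boolSum P.eval) ^ d) ^ 2 := by
    rw [hW, hA, map_mul, map_pow, aeval_entries_perPoly, hper', aeval_C, algebraMap_eq]
  have hWeval : ∀ x : Fin n → Bool, eval (toK ℤ ∘ x) W = (Wv x : ℤ) := by
    intro x
    rw [hWeq]
    simp only [map_pow, map_mul, eval_C, hfeval x, hWv]
    push_cast
    rw [sq_abs]
    ring
  -- [5] the cost of `W`
  have hτ : constantFreeComplexity W ≤ T := by
    have h1 : constantFreeComplexity W ≤
        constantFreeComplexity (aeval (fun ij : Fin pd × Fin pd => B' ij.1 ij.2) A.det) + 1 :=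
      constantFreeComplexity_sq_le _
    have h2 := constantFreeComplexity_aeval_le A.det (fun ij : Fin pd × Fin pd => B' ij.1 ij.2)
    have h3 : ∑ ij : Fin pd × Fin pd, constantFreeComplexity (B' ij.1 ij.2) ≤ pd * pd * (pd + 2) :=
      calc ∑ ij : Fin pd × Fin pd, constantFreeComplexity (B' ij.1 ij.2)
          ≤ ∑ _ij : Fin pd × Fin pd, (pd + 2) :=
            Finset.sum_le_sum fun ij _ => (hB' ij.1 ij.2).constantFreeComplexity_le
        _ = pd * pd * (pd + 2) := by
            simp [Finset.sum_const, Finset.card_univ, Fintype.card_prod, Fintype.card_fin]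
    have h4 := constantFreeComplexity_det_le A
    have h5 : ∑ ij : Fin mA × Fin mA, constantFreeComplexity (A ij.1 ij.2) ≤
        mA * mA * (2 * (pd * pd) + 1) :=
      calc ∑ ij : Fin mA × Fin mA, constantFreeComplexity (A ij.1 ij.2)
          ≤ ∑ _ij : Fin mA × Fin mA, (2 * (pd * pd) + 1) := Finset.sum_le_sum fun ij _ =>
            (constantFreeComplexity_le_of_affine_unit (hdeg ij.1 ij.2) (hco ij.1 ij.2)).trans
              (by simp [Fintype.card_prod, Fintype.card_fin])
        _ = mA * mA * (2 * (pd * pd) + 1) := by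
            simp [Finset.sum_const, Finset.card_univ, Fintype.card_prod, Fintype.card_fin]
    have h6 : constantFreeComplexity (detPoly (Fin mA) ℤ) ≤ X ^ c₁ + c₁ :=
      (hdet mA).trans (Nat.add_le_add_right (Nat.pow_le_pow_left hmA c₁) c₁)
    have h7 : mA * mA * (2 * (pd * pd) + 1) ≤ X * X * (2 * (pd * pd) + 1) := by gcongr
    rw [hT]
    omega
  -- [6] an optimal circuit for `W`, simulated modulo `2^ℓ`
  obtain ⟨Rc, hRc2, -, hRce, hRcs⟩ := exists_computes_size_eq_constantFreeComplexity W
  obtain ⟨hNzB, hdB⟩ := signDetExpr_bounds A (by omega) hNz hdeg hco hA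
  have hEle : mA * mA + 2 * pd * pd * mA ≤ E := by rw [hE]; gcongr
  have hℓ1 : 1 ≤ ℓ := by rw [hℓ]; omega
  haveI : NeZero (2 ^ ℓ) := ⟨pow_ne_zero _ two_ne_zero⟩
  have hsim := cktSize_testBits_aeval_eval (p := 2 ^ ℓ) le_rfl
    (fun (x : Fin n → Bool) (v : Fin n) => if x v then (1 : ZMod (2 ^ ℓ)) else 0)
    (fun v => cktSize_inputResidue' (ι := Fin n) hℓ1 v) Rc hRc2
  have hWv_lt : ∀ x, Wv x < 2 ^ ℓ := by
    intro x
    have h1 : Nz.natAbs ^ 2 ≤ (2 ^ E) ^ 2 :=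
      Nat.pow_le_pow_left (hNzB.trans (Nat.pow_le_pow_right Nat.two_pos hEle)) 2
    have h2 : (2 ^ pd * cnt x) ^ (2 * d) ≤ (2 ^ (pd + m)) ^ (2 * E) :=
      calc (2 ^ pd * cnt x) ^ (2 * d) ≤ (2 ^ pd * 2 ^ m) ^ (2 * d) :=
            Nat.pow_le_pow_left (Nat.mul_le_mul_left _ (hcnt_le x)) _
        _ = (2 ^ (pd + m)) ^ (2 * d) := by rw [pow_add]
        _ ≤ (2 ^ (pd + m)) ^ (2 * E) := Nat.pow_le_pow_right (Nat.two_pow_pos _) (by omega)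
    calc Wv x ≤ (2 ^ E) ^ 2 * (2 ^ (pd + m)) ^ (2 * E) := Nat.mul_le_mul h1 h2
      _ = 2 ^ (2 * E * (pd + m + 1)) := by
          rw [← pow_mul, ← pow_mul, ← pow_add]
          congr 1
          ring
      _ < 2 ^ ℓ := Nat.pow_lt_pow_right (by norm_num) (by rw [hℓ]; omega)
  have hval : ∀ x : Fin n → Bool,
      (aeval (fun v => if x v then (1 : ZMod (2 ^ ℓ)) else 0) Rc.eval).val = Wv x := by
    intro x
    have hz : (fun v => if x v then (1 : ZMod (2 ^ ℓ)) else 0) =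
        fun v => (((toK ℤ ∘ x) v : ℤ) : ZMod (2 ^ ℓ)) := by
      funext v
      by_cases h : x v <;> simp [toK, h]
    have hRce' : Rc.eval = W := hRce
    rw [hz, hRce', aeval_intCast_point, hWeval x, Int.cast_natCast, ZMod.val_natCast_of_lt (hWv_lt x)]
  -- [7] the threshold comparison `W(x) ≥ N² (2^p (2^m / 2 + 1))^{2d}`
  have hbits : CktSize B2 (fun x => testBits ℓ (Wv x)) ((Rc.size + 1) * gateCost ℓ 1) :=
    hsim.congr fun x i => by rw [hval x]
  have hcmp := tbd_cktSize_decide_le (Nz.natAbs ^ 2 * (2 ^ pd * (2 ^ m / 2 + 1)) ^ (2 * d)) hbits hWv_lt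
  refine (hcmp.congr fun x _ => ?_).of_le ?_
  · rw [hcnt_eq x, decide_eq_decide, hWv]
    have hNz2 : 0 < Nz.natAbs ^ 2 := Nat.pow_pos (Int.natAbs_pos.mpr hNz)
    rw [Nat.mul_le_mul_left_iff hNz2, Nat.pow_le_pow_iff_left (by omega),
      Nat.mul_le_mul_left_iff (Nat.two_pow_pos pd)]
    omega
  · -- size
    have h1 : (Rc.size + 1) * gateCost ℓ 1 ≤ (T + 1) * (2 * 1 + 65 * (ℓ + 2) ^ 3) :=
      Nat.mul_le_mul (by rw [hRcs]; exact Nat.succ_le_succ hτ) (gateCost_le ℓ 1)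
    omega

/-! ### The stub: `PP` has quasi-polynomial-size circuits -/

/-- **Lemma 2.12 at quasi-polynomial granularity, sign-determinantal form (Boolean side of the
crux `TauBurgisserDet`).** If `τ(DET_m)` is p-bounded and, for all large `n`, some
`N · per_n^d` (`N ≠ 0`, `d ≥ 1`) is the determinant of an `m × m` matrix of affine forms with
coefficients in `{−1, 0, 1}` and `m ≤ 2^((log₂ n + c)^c)`, then `PP ⊆ ⋃_c SIZE(2^((log₂ n + c)^c))`:
for `L ∈ PP = P·P` with witness relation `R ∈ P ⊆ P/poly` and `p(n)` coins, the majority bit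
`[2^{p(n)} < 2 #{y | ⟨x, y⟩ ∈ R}]` (`half_lt_uniformProb_iff`) is computed at every length `n` by
the circuit of `tbd_cktSize_majority` at the padded dimension
`pd(n) = n₀ + cfBound + 60 S + 3 ≥ n₀` (so the sign-determinantal expression exists for every `n`),
and its size is quasi-polynomial in `n` (`tbd_isQPBounded_size`, `IsQPBounded.two_pow_qexp_log`: qp ∘ poly = qp).
[cite: Burgisser2009, Lemma 2.12] -/
theorem stub_perBitsQP :
    (Literature.Computability.AlgebraicComplexity.IsPBounded fun m =>
        Literature.Computability.AlgebraicComplexity.constantFreeComplexity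
          (Literature.Computability.AlgebraicComplexity.detPoly (Fin m) ℤ)) →
    (∃ c n₀ : ℕ, ∀ n ≥ n₀, ∃ (m d : ℕ) (N : ℤ)
        (A : Matrix (Fin m) (Fin m) (MvPolynomial (Fin n × Fin n) ℤ)),
        1 ≤ d ∧ m ≤ 2 ^ ((Nat.log 2 n + c) ^ c) ∧ N ≠ 0 ∧ (∀ i j, (A i j).totalDegree ≤ 1) ∧
          (∀ i j s, |MvPolynomial.coeff s (A i j)| ≤ 1) ∧
          A.det = MvPolynomial.C N * Literature.Computability.AlgebraicComplexity.perPoly (Fin n) ℤ ^ d) →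
      Literature.Computability.Complexity.PP ⊆
        ⋃ c : ℕ, Literature.Computability.Complexity.SIZE (fun n => 2 ^ ((Nat.log 2 n + c) ^ c)) := by
  rintro ⟨c₁, hdet⟩ ⟨c, n₀, hSD⟩ L ⟨R, hRP, p, hLR⟩
  obtain ⟨q, hq⟩ := exists_cktSize_boolPair_of_mem_PPoly (P_subset_PPoly_holds hRP)
  -- the certificate length, the pair-circuit size and the padded dimension, p-bounded in `n`
  set pf : ℕ → ℕ := fun n => p.eval n with hpf
  set S : ℕ → ℕ := fun n => (2 * n + 2 + pf n) + q.eval (2 * n + 2 + pf n) with hS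
  set CF : ℕ → ℕ := fun n => cfBound (60 * S n + 1) (3 * S n + 2) (pf n + S n) with hCF
  set pd : ℕ → ℕ := fun n => n₀ + (CF n + 60 * S n + 3) with hpd
  have hp : IsPBounded pf := (isPBounded_iff_exists_polynomial_holds pf).2 ⟨p, fun n => le_rfl⟩
  have hlin : IsPBounded fun n => 2 * n + 2 + pf n :=
    IsPBounded.add_holds (IsPBounded.add_holds (IsPBounded.mul_holds (IsPBounded.const 2) IsPBounded.id)
      (IsPBounded.const 2)) hp
  have hq' : IsPBounded fun k => q.eval k :=
    (isPBounded_iff_exists_polynomial_holds _).2 ⟨q, fun n => le_rfl⟩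
  have hSb : IsPBounded S := IsPBounded.add_holds hlin (IsPBounded.comp_holds hq' hlin)
  have hCFb : IsPBounded CF :=
    isPBounded_cfBound
      (IsPBounded.add_holds (IsPBounded.mul_holds (IsPBounded.const 60) hSb) (IsPBounded.const 1))
      (IsPBounded.add_holds (IsPBounded.mul_holds (IsPBounded.const 3) hSb) (IsPBounded.const 2))
      (IsPBounded.add_holds hp hSb)
  have hpdb : IsPBounded pd :=
    IsPBounded.add_holds (IsPBounded.const n₀) (IsPBounded.add_holds (IsPBounded.add_holds hCFb
      (IsPBounded.mul_holds (IsPBounded.const 60) hSb)) (IsPBounded.const 3))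
  -- the sign-determinantal expressions at the padded dimensions `pd n ≥ n₀`
  have hSD' : ∀ n, ∃ (mA d : ℕ) (Nz : ℤ)
      (A : Matrix (Fin mA) (Fin mA) (MvPolynomial (Fin (pd n) × Fin (pd n)) ℤ)),
      1 ≤ d ∧ mA ≤ 2 ^ ((Nat.log 2 (pd n) + c) ^ c) ∧ Nz ≠ 0 ∧ (∀ i j, (A i j).totalDegree ≤ 1) ∧
        (∀ i j s, |coeff s (A i j)| ≤ 1) ∧ A.det = C Nz * perPoly (Fin (pd n)) ℤ ^ d :=
    fun n => hSD (pd n) (by simp only [hpd]; omega)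
  choose mA d Nz A hd hmA hNz hdeg hco hA using hSD'
  -- the size parameters `X = 2^((log pd + c)^c) ≥ mA`, `E`, `ℓ`, `T`, quasi-polynomial in `n`
  set X : ℕ → ℕ := fun n => 2 ^ ((Nat.log 2 (pd n) + c) ^ c) with hX
  obtain ⟨E, hE⟩ : ∃ E : ℕ → ℕ, ∀ n, E n = X n * X n + 2 * pd n * pd n * X n := ⟨_, fun n => rfl⟩
  obtain ⟨ℓ, hℓ⟩ : ∃ ℓ : ℕ → ℕ, ∀ n, ℓ n = 2 * E n * (pd n + pf n + 1) + 1 := ⟨_, fun n => rfl⟩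
  obtain ⟨T, hT⟩ : ∃ T : ℕ → ℕ, ∀ n, T n =
      X n ^ c₁ + c₁ + X n * X n * (2 * (pd n * pd n) + 1) + pd n * pd n * (pd n + 2) + 1 :=
    ⟨_, fun n => rfl⟩
  have hXb : IsQPBounded X := IsQPBounded.two_pow_qexp_log hpdb c
  have hpdq : IsQPBounded pd := hpdb.isQPBounded
  have hpp : IsQPBounded fun n => pd n * pd n := IsQPBounded.mul hpdq hpdq
  have hEb : IsQPBounded E := IsQPBounded.mono
    (IsQPBounded.add (IsQPBounded.mul hXb hXb) (IsQPBounded.mul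
      (IsQPBounded.mul (IsQPBounded.mul (IsQPBounded.const 2) hpdq) hpdq) hXb))
    fun n => (hE n).le
  have hℓb : IsQPBounded ℓ := IsQPBounded.mono
    (IsQPBounded.add (IsQPBounded.mul (IsQPBounded.mul (IsQPBounded.const 2) hEb)
      (IsQPBounded.add (IsQPBounded.add hpdq hp.isQPBounded) (IsQPBounded.const 1)))
      (IsQPBounded.const 1))
    fun n => (hℓ n).le
  have hTb : IsQPBounded T := IsQPBounded.mono
    (IsQPBounded.add (IsQPBounded.add (IsQPBounded.add (IsQPBounded.add
      (IsQPBounded.pow hXb c₁) (IsQPBounded.const c₁))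
      (IsQPBounded.mul (IsQPBounded.mul hXb hXb) (IsQPBounded.add
        (IsQPBounded.mul (IsQPBounded.const 2) hpp) (IsQPBounded.const 1))))
      (IsQPBounded.mul hpp (IsQPBounded.add hpdq (IsQPBounded.const 2))))
      (IsQPBounded.const 1))
    fun n => (hT n).le
  obtain ⟨C₀, hC₀⟩ := tbd_isQPBounded_size hTb hℓb
  -- the circuits
  have key : ∀ n, CktSize B2 (fun (x : Fin n → Bool) (_ : Unit) => L.boolIndicator (List.ofFn x))
      (2 ^ ((Nat.log 2 n + C₀) ^ C₀)) := by
    intro n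
    have h := tbd_cktSize_majority hdet R n (pf n) (S n) (CF n) (pd n) (X n) le_rfl
      (by simp only [hpd]; omega) (hq n (pf n)) (A n) (hd n) (hmA n) (hNz n) (hdeg n) (hco n) (hA n)
      (E n) (ℓ n) (T n) (hE n) (hℓ n) (hT n)
    refine (h.congr fun x _ => ?_).of_le (hC₀ n)
    have hx := hLR (List.ofFn x)
    rw [List.length_ofFn, half_lt_uniformProb_iff, ← PPSharpP.countWitnesses_eq_cnt] at hx
    by_cases hxL : List.ofFn x ∈ L
    · rw [(Set.mem_iff_boolIndicator _ _).1 hxL]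
      exact decide_eq_true (hx.1 hxL)
    · rw [(Set.notMem_iff_boolIndicator _ _).1 hxL]
      exact decide_eq_false (mt hx.2 hxL)
  refine Set.mem_iUnion.2 ⟨C₀, ?_⟩
  choose Ck hCk using fun n => (key n).toCircuit
  refine ⟨Ck, fun n => ⟨(hCk n).1, (hCk n).2.1⟩, fun x => ?_⟩
  rw [(hCk x.length).2.2 x.get]
  exact congrArg L.boolIndicator (List.ofFn_get x)

end Summit.ValiantsHypothesis.ValiantsHypothesis.Theorems.IntegralOrbitsTauBurgisserDet
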